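import Mathlib
import HarnessLib
import Literature.Analysis.FluidPDE.KNSSNoAxisymmetricTypeIHolds
import Literature.Analysis.FluidPDE.AxisymmetricL3OffAxis
import Summits.NavierStokesRegularity.NavierStokesRegularity.Theses.StretchingWellBinding
import Summits.NavierStokesRegularity.NavierStokesRegularity.Theses.CertifiedBlowup
import Summits.NavierStokesRegularity.NavierStokesRegularity.Theses.TypeIIInviscidRelaxation
import Summits.NavierStokesRegularity.NavierStokesRegularity.Theorems.AxisymmetricSwirlRegularity
import Summits.NavierStokesRegularity.NavierStokesRegularity.Theorems.LerayQuarterDissipationRecordTimeTypeI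
import Summits.NavierStokesRegularity.NavierStokesRegularity.Theorems.CertifiedBlowupCertifiedBlowupAxisymBlowupSwirlPersists
import Summits.NavierStokesRegularity.NavierStokesRegularity.Theorems.CertifiedBlowupCertifiedBlowupAxisymBlowupIffNotAxisymRegular
import Summits.NavierStokesRegularity.NavierStokesRegularity.Theorems.TypeIIInviscidRelaxationAxisymSwirlRegularOfNoBlowup

/-!
# Shelf 1574 calibration, landed: `EnstrophyQuarterLaw ⇒ axisymmetric-with-swirl regularity`

Helper file for the crux `StretchingWellBinding.EnstrophyQuarterLaw` (stmt-NavierStokesRegularity-1574,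
the residual of the whole enstrophy-quarter-law shelf), landed `--supports stmt-NavierStokesRegularity-1574
--as helper`. It discharges, sorry-free and from theorems ALREADY in the tree, the hardness calibration
`Cruxes/EnstrophyQuarterLaw/AxisymCalibration.lean` (ns-idea-9 g2, f70f860c6bdd): the quarter law
`∫|curl u(t)|² ≤ K/√(T-t)` for every finite-energy classical blow-up ALONE settles the axisymmetric (swirl
allowed) case of Clay (A) — a named OPEN problem — because

* the slice law forces the sup-norm Type-I rate (`…Theorems.lerayQuarterDissipation_recordTimeTypeI_proof`,
  closed item 19762 `RecordTimeTypeI`), and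
* axisymmetric Type-I blow-up is excluded (Koch–Nadirashvili–Seregin–Šverák 2009 Thm 6.1–6.2 /
  Seregin–Šverák 2009 Thm 1.1, DISCHARGED in the tree: `Literature.Analysis.FluidPDE.knss_no_axisymmetric_typeI_holds`,
  barrier `Literature.Barriers.NavierStokesRegularity.AxisymmetricTypeIExclusion_holds`).

Contents (all compositions of tree theorems; the bookkeeping the calibration card priced at "2 × M" is
already in the tree — sub-slab boundedness `…CompactAmplification.bounded_before_of_lerayHopf_classical`,
the on-axis step `axisymmetric_typeI_bounded_holds`, the off-axis step WITHOUT a rate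
`axisymmetricL3_boundedNearTop_offAxis` (Seregin 2014 Thm 1.4 ε-regularity + rotation packing of the
dissipation), and the Clay dichotomy `certifiedBlowupAxisymBlowup_iff_not_axisymmetricSwirlRegularity_summit`):

* `onAxisVertexRegular`, `offAxisVertexRegular` — the calibration's two stubs `stub_onAxisVertexRegular`,
  `stub_offAxisVertexRegular` with their signatures VERBATIM (by-name retirement in the Cruxes file:
  `theorem stub_onAxisVertexRegular : … := …Theorems.EnstrophyQuarterLaw.AxisymCalibration.onAxisVertexRegular`,
  same for the off-axis stub);
* `axisymmetricNoBlowup_of_enstrophyQuarterLaw` — the calibration itself, `EnstrophyQuarterLaw →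
  AxisymmetricNoBlowup` with the Cruxes-local `AxisymmetricNoBlowup` UNFOLDED VERBATIM (slice-wise
  axisymmetric classical Leray–Hopf evolutions from rapidly decaying data extend past `T`);
* BY NAME against the tree's statements of the axisymmetric-with-swirl problem:
  `axisymmetricSwirlRegularity_of_enstrophyQuarterLaw : EnstrophyQuarterLaw →
  Summit.NavierStokesRegularity.NavierStokesRegularity.AxisymmetricSwirlRegularity` (canonical conjecture
  leaf ns.S25), `axisymmetricSwirlRegularityWall_of_enstrophyQuarterLaw` (route item 11332 of `CertifiedBlowup`),
  `axisymSwirlRegular_of_enstrophyQuarterLaw` (hard core 1964 of `TypeIIInviscidRelaxation`), and the KILL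
  INSTRUMENT of the shelf `not_enstrophyQuarterLaw_of_certifiedBlowupAxisymBlowup :
  CertifiedBlowupAxisymBlowup → ¬ EnstrophyQuarterLaw` (crux 0727: ANY rigorous axisymmetric finite-energy
  blow-up from a rapidly decaying datum, rate irrelevant, refutes the quarter law and with it every route
  resting on shelf 1574).

WHAT THIS IS NOT: no statement about Navier–Stokes regularity is proved here; `EnstrophyQuarterLaw` (1574),
`AxisymmetricSwirlRegularity` (ns.S25), `CertifiedBlowupAxisymBlowup` (0727) all stay OPEN — the file only
records, kernel-checked, that the first implies the second and is refuted by the third.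

## References

* G. Koch, N. Nadirashvili, G. Seregin, V. Šverák, Acta Math. 203 (2009) 83–105, Thm 6.1–6.2.
* G. Seregin, V. Šverák, Comm. PDE 34 (2009) 171–201, Thm 1.1 (= Thm 3.1) and §3.
* L. Caffarelli, R. Kohn, L. Nirenberg, Comm. Pure Appl. Math. 35 (1982), Thm B; G. Seregin,
  *Lecture notes on regularity theory for the Navier–Stokes equations* (2014), Ch. 6 Thm 1.4.
-/

noncomputable section

-- the summit-side namespace repeats a component by design (D-0017)
set_option linter.dupNamespace false

namespace Summit.NavierStokesRegularity.NavierStokesRegularity.Theorems.EnstrophyQuarterLaw.AxisymCalibration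

open Set MeasureTheory Function Metric Filter Topology
open scoped ENNReal
open Literature.Analysis.FluidPDE
open Summit.NavierStokesRegularity.NavierStokesRegularity.Theorems.CertifiedBlowupAxisymBlowup.CompactAmplification

/-! ### Bookkeeping: a pointwise bound near `(T, x₀)` in the `L^∞(Q_r(T, x₀))` form of the stubs -/

/-- A pointwise bound on a backward parabolic neighbourhood `(T - r², T) × B(x₀, r)` gives, after
shrinking the radius so that `r'² < T`, an essential bound on the tree's backward cylinder
`parabolicCylinder r' (T, x₀)` — the `L^∞` form in which the calibration's stubs conclude. [folklore] -/
theorem exists_eLpNorm_parabolicCylinder_lt_top_of_bound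
    {u : ℝ → EuclideanSpace ℝ (Fin 3) → EuclideanSpace ℝ (Fin 3)} {T r K : ℝ}
    {x₀ : EuclideanSpace ℝ (Fin 3)} (hT : 0 < T) (hr : 0 < r)
    (hK : ∀ t ∈ Ioo (T - r ^ 2) T, ∀ x ∈ ball x₀ r, ‖u t x‖ ≤ K) :
    ∃ r' : ℝ, 0 < r' ∧ r' ^ 2 < T ∧
      eLpNorm (uncurry u) ⊤ (volume.restrict (parabolicCylinder r' ((T : ℝ), x₀))) < ⊤ := by
  set r' : ℝ := min r (Real.sqrt (T / 2)) with hr'def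
  have hr'pos : 0 < r' := lt_min hr (Real.sqrt_pos.2 (by positivity))
  have hr'le : r' ≤ r := min_le_left _ _
  have hr'sq : r' ^ 2 < T := by
    have h1 : r' ≤ Real.sqrt (T / 2) := min_le_right _ _
    have h2 : r' ^ 2 ≤ Real.sqrt (T / 2) ^ 2 := pow_le_pow_left₀ hr'pos.le h1 2
    rw [Real.sq_sqrt (by positivity)] at h2
    linarith
  have hK' : ∀ t ∈ Ioo (T - r' ^ 2) T, ∀ x ∈ ball x₀ r', ‖u t x‖ ≤ K :=
    IsBoundedNearTop.of_le hr'pos hr'le hK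
  refine ⟨r', hr'pos, hr'sq, ?_⟩
  have hbound : ∀ᵐ z ∂(volume.restrict (parabolicCylinder r' ((T : ℝ), x₀))), ‖uncurry u z‖ ≤ K := by
    rw [ae_restrict_iff' (isOpen_parabolicCylinder r' ((T : ℝ), x₀)).measurableSet]
    refine Filter.Eventually.of_forall fun z hz => ?_
    rw [mem_parabolicCylinder] at hz
    exact hK' z.1 hz.1 z.2 (mem_ball.2 hz.2)
  calc eLpNorm (uncurry u) ⊤ (volume.restrict (parabolicCylinder r' ((T : ℝ), x₀)))
      ≤ ENNReal.ofReal K := by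
        rw [eLpNorm_exponent_top]
        exact eLpNormEssSup_le_of_ae_bound hbound
    _ < ⊤ := ENNReal.ofReal_lt_top

/-! ### The two stubs of the calibration, verbatim -/

/-- **On-axis vertex (the KNSS / Seregin–Šverák step), signature of `stub_onAxisVertexRegular` verbatim.**
Under the sup-norm Type-I rate an axisymmetric (slice-wise) classical Leray–Hopf solution from a rapidly
decaying datum is essentially bounded on a backward cylinder about every vertex `(T, x₀)` on the axis — in
fact about EVERY vertex: the tree's `axisymmetric_typeI_bounded_holds` (KNSS 2009 Thm 6.2 with
Seregin–Šverák 2009 Thm 1.1 on the axis, CKN off it, far-field decay of Kato solutions) bounds `u` on the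
whole of `[0, T) × ℝ³`, its sub-slab hypothesis being `bounded_before_of_lerayHopf_classical`.
[cite: KochNadirashviliSereginSverak2009, Thm 6.2] -/
theorem onAxisVertexRegular :
    ∀ (ν T : ℝ), 0 < ν → 0 < T →
    ∀ (u : ℝ → EuclideanSpace ℝ (Fin 3) → EuclideanSpace ℝ (Fin 3)) (p : ℝ → EuclideanSpace ℝ (Fin 3) → ℝ),
      Literature.Analysis.FluidPDE.IsClassicalNSSolutionOn (Set.Ico 0 T) ν 0 u p →
      Literature.Analysis.FluidPDE.IsLerayHopfOn T ν 0 (u 0) u →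
      Literature.Analysis.FluidPDE.HasRapidSpatialDecay (u 0) →
      (∀ t ∈ Set.Ico 0 T, Literature.Analysis.FluidPDE.IsAxisymmetric (u t)) →
      Literature.Analysis.FluidPDE.IsTypeIBlowup u T →
      ∀ x₀ : EuclideanSpace ℝ (Fin 3), x₀ 0 = 0 → x₀ 1 = 0 →
        ∃ r : ℝ, 0 < r ∧ r ^ 2 < T ∧
          eLpNorm (uncurry u) ⊤ (volume.restrict
            (Literature.Analysis.FluidPDE.parabolicCylinder r ((T : ℝ), x₀))) < ⊤ := by
  intro ν T hν hT u p hcl hLH hdec hax hI x₀ _ _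
  have hbdd : ∀ T' < T, ∃ M : ℝ, ∀ t ∈ Icc 0 T', ∀ x, ‖u t x‖ ≤ M :=
    bounded_before_of_lerayHopf_classical hν hcl hLH hdec (hax 0 ⟨le_rfl, hT⟩)
  obtain ⟨M, hM⟩ := axisymmetric_typeI_bounded_holds hν hT hcl hLH hbdd hax hI
  have hρ : 0 < Real.sqrt (T / 2) := Real.sqrt_pos.2 (by positivity)
  refine exists_eLpNorm_parabolicCylinder_lt_top_of_bound (r := Real.sqrt (T / 2)) (K := M) hT hρ ?_
  intro t ht x _
  have hsq : Real.sqrt (T / 2) ^ 2 = T / 2 := Real.sq_sqrt (by positivity)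
  exact hM t ⟨by linarith [ht.1], ht.2⟩ x

/-- **Off-axis vertex (the CKN step, no rate hypothesis), signature of `stub_offAxisVertexRegular` verbatim.**
An axisymmetric (slice-wise) classical Leray–Hopf solution from a rapidly decaying datum is essentially
bounded on a backward cylinder about every vertex `(T, x₀)` OFF the axis: the tree's
`axisymmetricL3_boundedNearTop_offAxis` (rotation packing of the finite dissipation + Seregin's
multi-scale ε-regularity criterion `seregin2014_thm14_holds`; Seregin–Šverák 2009 §3: "all singular points
must belong to the axis of symmetry") for the standing hypotheses `AxisymmetricL3Hyp`, whose sub-slab bound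
is `bounded_before_of_lerayHopf_classical`. [cite: SereginSverak2009, §3 (arXiv p. 9)] -/
theorem offAxisVertexRegular :
    ∀ (ν T : ℝ), 0 < ν → 0 < T →
    ∀ (u : ℝ → EuclideanSpace ℝ (Fin 3) → EuclideanSpace ℝ (Fin 3)) (p : ℝ → EuclideanSpace ℝ (Fin 3) → ℝ),
      Literature.Analysis.FluidPDE.IsClassicalNSSolutionOn (Set.Ico 0 T) ν 0 u p →
      Literature.Analysis.FluidPDE.IsLerayHopfOn T ν 0 (u 0) u →
      Literature.Analysis.FluidPDE.HasRapidSpatialDecay (u 0) →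
      (∀ t ∈ Set.Ico 0 T, Literature.Analysis.FluidPDE.IsAxisymmetric (u t)) →
      ∀ x₀ : EuclideanSpace ℝ (Fin 3), ¬ (x₀ 0 = 0 ∧ x₀ 1 = 0) →
        ∃ r : ℝ, 0 < r ∧ r ^ 2 < T ∧
          eLpNorm (uncurry u) ⊤ (volume.restrict
            (Literature.Analysis.FluidPDE.parabolicCylinder r ((T : ℝ), x₀))) < ⊤ := by
  intro ν T hν hT u p hcl hLH hdec hax x₀ hx₀
  have H : AxisymmetricL3Hyp ν T u p :=
    ⟨hν, hT, hcl, hLH, bounded_before_of_lerayHopf_classical hν hcl hLH hdec (hax 0 ⟨le_rfl, hT⟩), hax⟩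
  have hcyl : cylRadius x₀ ≠ 0 := fun h => hx₀ ((cylRadius_eq_zero_iff x₀).1 h)
  obtain ⟨r, hr, K, hK⟩ := axisymmetricL3_boundedNearTop_offAxis H x₀ hcyl
  exact exists_eLpNorm_parabolicCylinder_lt_top_of_bound hT hr hK

/-! ### The calibration: `EnstrophyQuarterLaw ⇒ AxisymmetricNoBlowup` (unfolded verbatim) -/

/-- **Calibration of shelf 1574: the enstrophy quarter law implies axisymmetric-with-swirl no-blow-up**
— `EnstrophyQuarterLaw → AxisymmetricNoBlowup` with the Cruxes-local `AxisymmetricNoBlowup`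
(`Cruxes/EnstrophyQuarterLaw/AxisymCalibration.lean`) unfolded verbatim: a classical Leray–Hopf solution
from a rapidly decaying datum whose slices `u t`, `t ∈ [0, T)`, are axisymmetric about the `x₃`-axis
extends smoothly past `T`. Proof: if it did not, `(u, p)` is maximal with lifespan `T`, the quarter law
gives `∫|curl u(t)|² ≤ K/√(T-t)`, `lerayQuarterDissipation_recordTimeTypeI_proof` the Type-I rate, and
`knss_no_axisymmetric_typeI_holds` (sub-slab bound from `bounded_before_of_lerayHopf_classical`) the
extension — contradiction. Equivalently: the Cruxes composition `axisymmetricNoBlowup_of_enstrophyQuarterLaw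
onAxisVertexRegular offAxisVertexRegular`. [cite: KochNadirashviliSereginSverak2009, Thm 6.1 and Thm 6.2] -/
theorem axisymmetricNoBlowup_of_enstrophyQuarterLaw
    (hQ : Summit.NavierStokesRegularity.NavierStokesRegularity.Theses.StretchingWellBinding.EnstrophyQuarterLaw) :
    ∀ (ν T : ℝ), 0 < ν → 0 < T →
    ∀ (u : ℝ → EuclideanSpace ℝ (Fin 3) → EuclideanSpace ℝ (Fin 3)) (p : ℝ → EuclideanSpace ℝ (Fin 3) → ℝ),
      Literature.Analysis.FluidPDE.IsClassicalNSSolutionOn (Set.Ico 0 T) ν 0 u p →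
      Literature.Analysis.FluidPDE.IsLerayHopfOn T ν 0 (u 0) u →
      Literature.Analysis.FluidPDE.HasRapidSpatialDecay (u 0) →
      (∀ t ∈ Set.Ico 0 T, Literature.Analysis.FluidPDE.IsAxisymmetric (u t)) →
      Literature.Analysis.FluidPDE.HasSmoothExtensionPast ν 0 u T := by
  intro ν T hν hT u p hcl hLH hdec hax
  by_contra hext
  obtain ⟨K, hK⟩ := hQ ν T hν hT u p ⟨hcl, hext⟩ hLH hdec
  have hI : IsTypeIBlowup u T :=
    Summit.NavierStokesRegularity.NavierStokesRegularity.Theorems.lerayQuarterDissipation_recordTimeTypeI_proof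
      ν T hν hT u p hcl hLH hdec K hK
  exact hext (hasSmoothExtensionPast_of_typeI_or_axisBound hν hT hcl hLH hdec (hax 0 ⟨le_rfl, hT⟩)
    (Or.inl hI))

/-! ### By name: the quarter law implies the axisymmetric-with-swirl regularity conjecture -/

/-- **`EnstrophyQuarterLaw ⇒ AxisymmetricSwirlRegularity`** (the CANONICAL conjecture leaf ns.S25,
`Theorems/AxisymmetricSwirlRegularity.lean`: global classical bounded-energy solutions for all smooth
divergence-free rapidly decaying axisymmetric data, swirl allowed — OPEN). The tree's
`axisymmetricSwirlRegularity_of_noBlowup` (nsreg-p3 ROUND-15: Kato dichotomy + grafting) reduces ns.S25 to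
no blow-up in the standing slice-wise axisymmetric, sub-slab-bounded class; under the quarter law that
class has no blow-up (`knss_no_axisymmetric_typeI_holds` after `lerayQuarterDissipation_recordTimeTypeI_proof`).
A conditional edge between two OPEN statements; nothing about either is asserted. [folklore] -/
theorem axisymmetricSwirlRegularity_of_enstrophyQuarterLaw
    (hQ : Summit.NavierStokesRegularity.NavierStokesRegularity.Theses.StretchingWellBinding.EnstrophyQuarterLaw) :
    Summit.NavierStokesRegularity.NavierStokesRegularity.AxisymmetricSwirlRegularity := by
  refine Summit.NavierStokesRegularity.NavierStokesRegularity.Theorems.axisymmetricSwirlRegularity_of_noBlowup ?_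
  intro ν T hν hT u p hcl hLH hbdd hax hdec
  by_contra hext
  obtain ⟨K, hK⟩ := hQ ν T hν hT u p ⟨hcl, hext⟩ hLH hdec
  have hI : IsTypeIBlowup u T :=
    Summit.NavierStokesRegularity.NavierStokesRegularity.Theorems.lerayQuarterDissipation_recordTimeTypeI_proof
      ν T hν hT u p hcl hLH hdec K hK
  exact hext (knss_no_axisymmetric_typeI_holds hν hT hcl hLH hbdd hax (Or.inl hI))

/-- **`EnstrophyQuarterLaw ⇒ AxisymSwirlRegular`** — the same against the hard core
stmt-NavierStokesRegularity-1964, the route decl `Theses.TypeIIInviscidRelaxation.AxisymSwirlRegular` BY NAME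
(its inline rotation clause is `IsAxisymmetric` by `Iff.rfl`; tree `axisymSwirlRegular_of_noBlowup`).
Conditional edge only. [folklore] -/
theorem axisymSwirlRegular_of_enstrophyQuarterLaw
    (hQ : Summit.NavierStokesRegularity.NavierStokesRegularity.Theses.StretchingWellBinding.EnstrophyQuarterLaw) :
    Summit.NavierStokesRegularity.NavierStokesRegularity.Theses.TypeIIInviscidRelaxation.AxisymSwirlRegular := by
  refine Summit.NavierStokesRegularity.NavierStokesRegularity.Theorems.axisymSwirlRegular_of_noBlowup ?_
  intro ν T hν hT u p hcl hLH hbdd hax hdec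
  by_contra hext
  obtain ⟨K, hK⟩ := hQ ν T hν hT u p ⟨hcl, hext⟩ hLH hdec
  have hI : IsTypeIBlowup u T :=
    Summit.NavierStokesRegularity.NavierStokesRegularity.Theorems.lerayQuarterDissipation_recordTimeTypeI_proof
      ν T hν hT u p hcl hLH hdec K hK
  exact hext (knss_no_axisymmetric_typeI_holds hν hT hcl hLH hbdd hax (Or.inl hI))

/-! ### The kill instrument of the shelf: an axisymmetric blow-up refutes the quarter law -/

/-- **`EnstrophyQuarterLaw ⇒ ¬ CertifiedBlowupAxisymBlowup`** (crux stmt-NavierStokesRegularity-0727 of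
route `CertifiedBlowup`: some maximal finite-energy classical solution of finite lifespan from a rapidly
decaying AXISYMMETRIC datum). A witness would be Type I by the quarter law
(`lerayQuarterDissipation_recordTimeTypeI_proof`), whereas every witness is Type II
(`not_isTypeIBlowup_of_isMaximalSmoothSolution`: symmetry propagation + `knss_no_axisymmetric_typeI_holds`).
[cite: KochNadirashviliSereginSverak2009, Thm 6.1 and Thm 6.2] -/
theorem not_certifiedBlowupAxisymBlowup_of_enstrophyQuarterLaw
    (hQ : Summit.NavierStokesRegularity.NavierStokesRegularity.Theses.StretchingWellBinding.EnstrophyQuarterLaw) :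
    ¬ Summit.NavierStokesRegularity.NavierStokesRegularity.Theses.CertifiedBlowup.CertifiedBlowupAxisymBlowup := by
  rintro ⟨ν, hν, T, hT, u, p, hmax, hLH, hdec, hax⟩
  obtain ⟨K, hK⟩ := hQ ν T hν hT u p hmax hLH hdec
  have hI : IsTypeIBlowup u T :=
    Summit.NavierStokesRegularity.NavierStokesRegularity.Theorems.lerayQuarterDissipation_recordTimeTypeI_proof
      ν T hν hT u p hmax.1 hLH hdec K hK
  exact not_isTypeIBlowup_of_isMaximalSmoothSolution hν hT hmax hLH hdec hax hI

/-- **KILL INSTRUMENT of shelf 1574: `CertifiedBlowupAxisymBlowup ⇒ ¬ EnstrophyQuarterLaw`.** Any rigorous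
axisymmetric finite-energy blow-up from a rapidly decaying datum (rate irrelevant — a Hou-type scenario
made rigorous) refutes the enstrophy quarter law, hence every route whose residual is shelf 1574
(StretchingWellBinding, LerayQuarterDissipation, CalmSliceGate, QuarterLogPincer, EfficiencyFloor,
QuarterBudgetTrace, QuarterJolt). Contrapositive of `not_certifiedBlowupAxisymBlowup_of_enstrophyQuarterLaw`.
[folklore] -/
theorem not_enstrophyQuarterLaw_of_certifiedBlowupAxisymBlowup
    (hC : Summit.NavierStokesRegularity.NavierStokesRegularity.Theses.CertifiedBlowup.CertifiedBlowupAxisymBlowup) :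
    ¬ Summit.NavierStokesRegularity.NavierStokesRegularity.Theses.StretchingWellBinding.EnstrophyQuarterLaw :=
  fun hQ => not_certifiedBlowupAxisymBlowup_of_enstrophyQuarterLaw hQ hC

/-- **`EnstrophyQuarterLaw ⇒ AxisymmetricSwirlRegularityWall`** (route item stmt-NavierStokesRegularity-11332
of `CertifiedBlowup`, definiens the transitional `Literature.Analysis.FluidPDE.AxisymmetricSwirlRegularity`):
through the kernel-checked identity `CertifiedBlowupAxisymBlowup ↔ ¬ AxisymmetricSwirlRegularity`
(`certifiedBlowupAxisymBlowup_iff_not_axisymmetricSwirlRegularity`, Clay dichotomy `clayOrBlowup`).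
Conditional edge only. [folklore] -/
theorem axisymmetricSwirlRegularityWall_of_enstrophyQuarterLaw
    (hQ : Summit.NavierStokesRegularity.NavierStokesRegularity.Theses.StretchingWellBinding.EnstrophyQuarterLaw) :
    Summit.NavierStokesRegularity.NavierStokesRegularity.Theses.CertifiedBlowup.AxisymmetricSwirlRegularityWall := by
  by_contra hAX
  exact not_certifiedBlowupAxisymBlowup_of_enstrophyQuarterLaw hQ
    (certifiedBlowupAxisymBlowup_iff_not_axisymmetricSwirlRegularity.2 hAX)

end Summit.NavierStokesRegularity.NavierStokesRegularity.Theorems.EnstrophyQuarterLaw.AxisymCalibration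

end
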